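import Literature.IUT.HodgeTheaters.DThetaPMEllHTStability
import Mathlib.CategoryTheory.EqToHom

/-!
# Representative-level isomorphisms of `𝒟-Θ^{±ell}`-Hodge theaters ([IUTchI] Def 6.4 (iii)) — the shape [IUTchIII] §1 consumes

Mochizuki, *Inter-universal Teichmüller Theory I*, kurims manuscript (May 2020), §6, Def 6.4 (i)–(iii)
pp. 162–163 (morphisms of `𝒟-Θ^±`-bridges, of `𝒟-Θ^{ell}`-bridges, of `𝒟-Θ^{±ell}`-Hodge theaters); *III*, kurims
(May 2020), Prop 1.3 (i) p. 42 and Rmk 1.3.1 p. 43 ("it was necessary to carry out the given construction of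
the log-link first for a single `Ξ` [i.e., as opposed to a poly-isomorphism `Ξ`]").
([IUTchI] Def 6.4 (iii) p.163) [claim: Mochizuki2012, status: disputed]. MERGE BRIDGE (plan/L6/MERGE-MAP.md §8 B10
part 2, `StripFrame.ofKits`, HT half), written by the consumer seat abc-iut-L6-t3 over abc-iut-L5-t4's LANDED
`PMBaseBridges.lean`; nothing of L5-t4's is restated, nothing of the series is asserted.

Print (Def 6.4 (i) p.162): a morphism of `𝒟-Θ^±`-bridges is "a pair of poly-morphisms `†𝔇_T ⥲ ‡𝔇_{T'}`;
`†𝔇_≻ ⥲ ‡𝔇_≻` — where `†𝔇_T ⥲ ‡𝔇_{T'}` is a capsule-`+`-full poly-isomorphism whose induced morphism on index sets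
`T ⥲ T'` is an isomorphism of `𝔽_l^±`-groups; `†𝔇_≻ ⥲ ‡𝔇_≻` is a `+`-full poly-isomorphism — which are compatible with
`†φ^{Θ±}_±`, `‡φ^{Θ±}_±`"; (ii) p.163: for `𝒟-Θ^{ell}`-bridges the second datum is "a poly-morphism which is an
`Aut_csp(†𝒟^{⊚±})`- [or, equivalently, `Aut_csp(‡𝒟^{⊚±})`-] orbit of isomorphisms" `†𝒟^{⊚±} ⥲ ‡𝒟^{⊚±}`; (iii) p.163: a
morphism of `𝒟-Θ^{±ell}`-Hodge theaters is "a pair of morphisms between the respective associated `𝒟-Θ^±`- and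
`𝒟-Θ^{ell}`-bridges that are compatible with one another in the sense that they induce the same poly-isomorphism
between the respective capsules of `𝒟`-prime-strips". abc-iut-L5-t4 typed these verbatim as RECORDS OF
POLY-DATA (`PMBaseKit.DThetaPMBridge.Iso`, `DThetaEllBridge.Iso`, `DThetaPMEllHT.Iso`).

What [IUTchIII] §1 needs in addition ([IUTchIII] Prop 1.3 (i), Rmk 1.3.1; the frame
`Literature.IUT.LogThetaLattice.StripFrame` of `PrimeStripFrame.lean`: a CATEGORY `DHT` of `𝒟`-Hodge theaters
with FUNCTORS `dstrip □ : DHT ⥤ D` to `𝒟`-prime-strips): SINGLE isomorphisms that compose and project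
functorially to their constituent prime-strip isomorphisms. This file supplies that REPRESENTATIVE level:

* `DRepIso H₁ H₂` — an isomorphism of `𝔽_l^±`-groups `ι : T ⥲ T'` of index sets together with SINGLE
  isomorphisms `caps t : †𝔇_t ⥲ ‡𝔇_{ι t}`, `cod : †𝔇_≻ ⥲ ‡𝔇_≻`, `glob : †𝒟^{⊚±} ⥲ ‡𝒟^{⊚±}` whose `+`-full orbits
  (`DStrip.plusFullPolyIso`, Def 6.1 (iv)) and `Aut_csp`-orbit satisfy the printed compatibility conditions of
  Def 6.4 (i) and (ii) (fields `compatPM`, `compatEll`, stated with L5-t4's `DStrip.polyComp` exactly as in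
  L5-t4's `Iso.compat` fields); the "same poly-isomorphism between the capsules" condition of (iii) holds by
  construction (ONE family `caps` serves both bridges);
* the TRANSPORT FORM of the Def 6.4 (ii) condition (`compatEll_iff_transport`: "`g ∈ ‡φ^{Θell}_{v_{ι t}}` iff
  `caps_t ∘ g ∘ glob⁻¹ ∈ †φ^{Θell}_{v_t}`"), equivalent to the printed form because `†φ^{Θell}` is
  `Aut_+`/`Aut_csp`-bistable (`DThetaPMEllHTStability`);
* `DRepIso.refl`, `DRepIso.trans`, `DRepIso.symm` (the compatibility conditions are closed under these), and
  the extensionality principle `DRepIso.ext_of_caps` (representatives are equal iff their DATA agree).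
The groupoid structure, the comparison with L5-t4's poly-level `DThetaPMEllHT.Iso`, and the strip-projection
functors follow in `DHodgeTheaterGroupoid.lean`. A printed (poly-level) isomorphism `Ξ` corresponds to the
SET of its representatives — a poly-isomorphism of the representative groupoid — which is how [IUTchIII]
Prop 1.3 (i) is typed (`HodgeTheaterLogLink`: `HTLogLink.Ξ : PolyIso`).
-/

namespace Literature.IUT.LogThetaLattice

open CategoryTheory
open Literature.IUT.HodgeTheaters Literature.IUT.HodgeTheaters.PMBaseKit

universe u

namespace DHTRep

variable {l : ℕ} {K : PMBaseKit.{u} l}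

/-! ### Transport along equalities of indices -/

/-- **IUTchI:Def6.4(iii)** (kurims p.163) Transport of the constituent `†𝔇_t` of the capsule `†𝔇_T` along an equality of
indices `t = t'` (the identity isomorphism, re-typed). ([IUTchI] Def 6.4 (iii) p.163) [claim: Mochizuki2012, status: disputed] -/
def capsCast (H : K.DThetaPMEllHT) {t t' : H.T} (h : t = t') : (H.capsule t).Iso (H.capsule t') :=
  fun v => eqToIso (congrArg (fun s => (H.capsule s).obj v) h)

/-- **IUTchI:Def6.4(iii)** (kurims p.163) Transport along `rfl` is the identity. ([IUTchI] Def 6.4 (iii) p.163) [claim: Mochizuki2012, status: disputed] -/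
@[simp] theorem capsCast_rfl (H : K.DThetaPMEllHT) (t : H.T) :
    capsCast H (rfl : t = t) = DStrip.Iso.refl (H.capsule t) := rfl

/-- **IUTchI:Def6.4(iii)** (kurims p.163) Transport is positive: it induces the identity on `±`-label classes of cusps at every
`v`. ([IUTchI] Def 6.1 (iii) p.157) [claim: Mochizuki2012, status: disputed] -/
theorem labMap_capsCast_trans (H : K.DThetaPMEllHT) {t t' : H.T} (h : t = t') {D : K.DStrip}
    (θ : ∀ s, (H.capsule s).Iso D) (v : K.V) :
    K.labMap v (capsCast H h v ≪≫ θ t' v) = K.labMap v (θ t v) := by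
  subst h
  simp [DStrip.Iso.refl]

/-- **IUTchI:Def6.4(iii)** (kurims p.163) `†φ^{Θell}_{v_t}` transported along `t = t'`: pre-composition with the transport
isomorphism carries `†φ^{Θell}_{v_{t'}}` onto `†φ^{Θell}_{v_t}`. ([IUTchI] Def 6.4 (ii) p.163) [claim: Mochizuki2012, status: disputed] -/
theorem polyEll_capsCast_iff (H : K.DThetaPMEllHT) {t t' : H.T} (h : t = t') (v : K.V)
    (k : (H.capsule t').obj v ⟶ (K.atV v).obj H.glob) :
    (capsCast H h v).hom ≫ k ∈ H.polyEll t v ↔ k ∈ H.polyEll t' v := by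
  subst h
  simp [DStrip.Iso.refl]

/-! ### Isomorphisms of `𝔽_l^±`-groups invert -/

/-- **IUTchI:Def6.1(i)** (kurims p.155) The inverse of an isomorphism of `𝔽_l^±`-groups (charts pull back to charts) is an
isomorphism of `𝔽_l^±`-groups. ([IUTchI] Def 6.1 (i) p.155) [claim: Mochizuki2012, status: disputed] -/
theorem isIso_symm {E E' : Type*} (S : FlPMGroup l E) (S' : FlPMGroup l E') {f : E ≃ E'}
    (hf : ∀ e' ∈ S'.charts, f.trans e' ∈ S.charts) : ∀ e ∈ S.charts, f.symm.trans e ∈ S'.charts := by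
  obtain ⟨e', he'⟩ := S'.nonempty
  refine (S'.isIso_iff_exists S _).mpr ⟨f.trans e', hf e' he', ?_⟩
  simpa only [← Equiv.trans_assoc, Equiv.symm_trans_self, Equiv.refl_trans] using he'

/-! ### The two forms of the `Θ^{ell}`-compatibility condition -/

/-- **IUTchI:Def6.4(ii)** (kurims p.163) TRANSPORT FORM of "compatible with `†φ^{Θell}_±`, `‡φ^{Θell}_±`" for single
representatives `c : †𝔇_t ⥲ ‡𝔇_{t₂}`, `γ : †𝒟^{⊚±} ⥲ ‡𝒟^{⊚±}`: the printed equality of composite poly-morphisms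
("`(Aut_+ · c) ∘ ‡φ^{Θell} = †φ^{Θell} ∘ (γ · Aut_csp)`") holds iff `‡φ^{Θell}_{v_{t₂}} = c ∘ †φ^{Θell}_{v_t} ∘ γ⁻¹`
elementwise — because `φ^{Θell}` is stable under `Aut_+` on the left and `Aut_csp` on the right (Example 6.3 (i)).
([IUTchI] Def 6.4 (ii) p.163) [claim: Mochizuki2012, status: disputed] -/
theorem compatEll_iff_transport {H₁ H₂ : K.DThetaPMEllHT} (t : H₁.T) (t₂ : H₂.T)
    (c : (H₁.capsule t).Iso (H₂.capsule t₂)) (γ : H₁.glob ≅ H₂.glob) (v : K.V) :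
    ({h | ∃ p ∈ DStrip.plusFullPolyIso c, ∃ g ∈ H₂.polyEll t₂ v, h = (p v).hom ≫ g} =
      {h | ∃ f ∈ H₁.polyEll t v, ∃ d ∈ K.autCsp H₂.glob, h = f ≫ (K.atV v).map (γ ≪≫ d).hom}) ↔
    ∀ g, g ∈ H₂.polyEll t₂ v ↔ (c v).hom ≫ g ≫ (K.atV v).map γ.inv ∈ H₁.polyEll t v := by
  have h1 : (1 : Aut H₂.glob) = Iso.refl _ := rfl
  -- a member of the `+`-full orbit of `c` differs from `c` by a positive automorphism
  have hpos : ∀ {p}, p ∈ DStrip.plusFullPolyIso c → K.labMap v ((c v).symm ≪≫ p v) = Equiv.refl _ :=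
    fun hp => (labMap_symm_trans_eq_refl_iff _ _).mpr ((DStrip.mem_plusFullPolyIso_iff.mp hp) v).symm
  -- conjugates of `Aut_csp(‡𝒟^{⊚±})` by `γ` fix the cusps of `†𝒟^{⊚±}`
  have hcsp : ∀ {d : Aut H₂.glob}, d ∈ K.autCsp H₂.glob → K.gLabMap (γ.symm.conjAut d) = Equiv.refl _ :=
    fun hd => MonoidHom.mem_ker.mp (autCsp_conjAut_mem γ.symm hd)
  constructor
  · intro hS g
    constructor
    · intro hg
      have hm : (c v).hom ≫ g ∈ {h | ∃ f ∈ H₁.polyEll t v, ∃ d ∈ K.autCsp H₂.glob,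
          h = f ≫ (K.atV v).map (γ ≪≫ d).hom} := by
        rw [← hS]; exact ⟨c, DStrip.self_mem_plusFullPolyIso c, g, hg, rfl⟩
      obtain ⟨f, hf, d, hd, hm⟩ := hm
      have key := H₁.polyEll_post_mem (hcsp hd) hf
      rw [← Category.assoc, hm]
      convert key using 1
      simp only [Iso.conjAut_apply, Iso.symm_symm_eq, Iso.trans_hom, Iso.symm_hom, Functor.map_comp,
        Category.assoc]
    · intro hx
      have hm : ((c v).hom ≫ g ≫ (K.atV v).map γ.inv) ≫ (K.atV v).map (γ ≪≫ (1 : Aut H₂.glob)).hom ∈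
          {h | ∃ p ∈ DStrip.plusFullPolyIso c, ∃ g ∈ H₂.polyEll t₂ v, h = (p v).hom ≫ g} := by
        rw [hS]; exact ⟨_, hx, 1, one_mem _, rfl⟩
      obtain ⟨p, hp, g₂, hg₂, hm⟩ := hm
      rw [h1] at hm
      simp only [Iso.trans_refl, Category.assoc, Iso.map_inv_hom_id, Category.comp_id] at hm
      -- hm : (c v).hom ≫ g = (p v).hom ≫ g₂
      have key := H₂.polyEll_pre_mem (hpos hp) hg₂
      convert key using 1
      rw [Iso.trans_hom, Iso.symm_hom, Category.assoc, ← hm, Iso.inv_hom_id_assoc]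
  · intro hT
    ext h
    simp only [Set.mem_setOf_eq]
    constructor
    · rintro ⟨p, hp, g, hg, rfl⟩
      have hf := (hT _).mp (H₂.polyEll_pre_mem (hpos hp) hg)
      refine ⟨_, hf, 1, one_mem _, ?_⟩
      rw [h1]
      simp only [Iso.trans_hom, Iso.symm_hom, Iso.trans_refl, Category.assoc, Iso.hom_inv_id_assoc]
      simp only [← Functor.map_comp, Iso.inv_hom_id, CategoryTheory.Functor.map_id, Category.comp_id]
    · rintro ⟨f, hf, d, hd, rfl⟩
      refine ⟨c, DStrip.self_mem_plusFullPolyIso c, (c v).inv ≫ f ≫ (K.atV v).map (γ ≪≫ d).hom, ?_, ?_⟩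
      · rw [hT]
        have key := H₁.polyEll_post_mem (hcsp hd) hf
        convert key using 1
        simp only [Iso.conjAut_apply, Iso.symm_symm_eq, Iso.trans_hom, Iso.symm_hom, Functor.map_comp,
          Category.assoc, Iso.hom_inv_id_assoc]
      · simp only [Iso.hom_inv_id_assoc]

/-! ### Representative-level isomorphisms -/

/-- **IUTchI:Def6.4(iii)** (kurims p.163) A **representative of an isomorphism of `𝒟-Θ^{±ell}`-Hodge theaters**
`†ℋ𝒯^{𝒟-Θ±ell} ⥲ ‡ℋ𝒯^{𝒟-Θ±ell}`: the induced isomorphism of `𝔽_l^±`-groups `ι : T ⥲ T'` of index sets and SINGLE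
isomorphisms `†𝔇_t ⥲ ‡𝔇_{ι(t)}` (`t ∈ T`), `†𝔇_≻ ⥲ ‡𝔇_≻`, `†𝒟^{⊚±} ⥲ ‡𝒟^{⊚±}` whose `+`-full orbits [Def 6.1 (iv)] and
`Aut_csp(‡𝒟^{⊚±})`-orbit satisfy the compatibility conditions of Def 6.4 (i) ("compatible with `†φ^{Θ±}_±`,
`‡φ^{Θ±}_±`") and Def 6.4 (ii) ("compatible with `†φ^{Θell}_±`, `‡φ^{Θell}_±`"); the condition of Def 6.4 (iii) ("induce
the same poly-isomorphism between the respective capsules") is built in: one family `caps` for both bridges.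
([IUTchI] Def 6.4 (iii) p.163) [claim: Mochizuki2012, status: disputed] -/
@[ext]
structure DRepIso (H₁ H₂ : K.DThetaPMEllHT) : Type u where
  /-- "induced morphism on index sets `T ⥲ T'`" -/
  ι : H₁.T ≃ H₂.T
  /-- "… is an isomorphism of `𝔽_l^±`-groups": charts pull back to charts -/
  ι_charts : ∀ e ∈ H₂.grpT.charts, ι.trans e ∈ H₁.grpT.charts
  /-- a representative `†𝔇_t ⥲ ‡𝔇_{ι(t)}` of each constituent of the capsule-`+`-full poly-isomorphism -/
  caps : ∀ t, (H₁.capsule t).Iso (H₂.capsule (ι t))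
  /-- a representative of the `+`-full poly-isomorphism `†𝔇_≻ ⥲ ‡𝔇_≻` -/
  cod : H₁.codomain.Iso H₂.codomain
  /-- a representative of the `Aut_csp`-orbit `†𝒟^{⊚±} ⥲ ‡𝒟^{⊚±}` -/
  glob : H₁.glob ≅ H₂.glob
  /-- Def 6.4 (i): "compatible with `†φ^{Θ±}_±`, `‡φ^{Θ±}_±`" — the composite poly-morphisms `†𝔇_t → ‡𝔇_≻` agree -/
  compatPM : ∀ t, DStrip.polyComp (DStrip.plusFullPolyIso (caps t)) (H₂.polyPM (ι t)) =
    DStrip.polyComp (H₁.polyPM t) (DStrip.plusFullPolyIso cod)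
  /-- Def 6.4 (ii): "compatible with `†φ^{Θell}_±`, `‡φ^{Θell}_±`" at every `t`, `v`, the poly-morphism
  `†𝒟^{⊚±} ⥲ ‡𝒟^{⊚±}` being the `Aut_csp(‡𝒟^{⊚±})`-orbit of `glob` -/
  compatEll : ∀ t v,
    {h | ∃ p ∈ DStrip.plusFullPolyIso (caps t), ∃ g ∈ H₂.polyEll (ι t) v, h = (p v).hom ≫ g} =
      {h | ∃ f ∈ H₁.polyEll t v, ∃ c ∈ K.autCsp H₂.glob, h = f ≫ (K.atV v).map (glob ≪≫ c).hom}

namespace DRepIso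

variable {H₁ H₂ H₃ : K.DThetaPMEllHT}

/-- **IUTchI:Def6.4(ii)** (kurims p.163) The `Θ^{ell}`-compatibility of a representative in transport form:
`‡φ^{Θell}_{v_{ι t}} = caps_t ∘ †φ^{Θell}_{v_t} ∘ glob⁻¹` elementwise. ([IUTchI] Def 6.4 (ii) p.163) [claim: Mochizuki2012, status: disputed] -/
theorem transport (f : DRepIso H₁ H₂) (t : H₁.T) (v : K.V)
    (g : (H₂.capsule (f.ι t)).obj v ⟶ (K.atV v).obj H₂.glob) :
    g ∈ H₂.polyEll (f.ι t) v ↔ (f.caps t v).hom ≫ g ≫ (K.atV v).map f.glob.inv ∈ H₁.polyEll t v :=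
  (compatEll_iff_transport t (f.ι t) (f.caps t) f.glob v).mp (f.compatEll t v) g

/-- **IUTchI:Def6.4(iii)** (kurims p.163) Two representatives with the same index bijection whose capsule representatives
agree after the evident re-typing, and with the same `†𝔇_≻ ⥲ ‡𝔇_≻` and `†𝒟^{⊚±} ⥲ ‡𝒟^{⊚±}`, are equal (the form of
extensionality used for the groupoid laws). ([IUTchI] Def 6.4 (iii) p.163) [claim: Mochizuki2012, status: disputed] -/
theorem ext_of_caps {f g : DRepIso H₁ H₂} (hι : f.ι = g.ι)
    (hcaps : ∀ t v, (f.caps t v).hom ≫ eqToHom (by rw [hι]) = (g.caps t v).hom)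
    (hcod : f.cod = g.cod) (hglob : f.glob = g.glob) : f = g := by
  obtain ⟨ι, _, caps, cod, glob, _, _⟩ := f
  obtain ⟨ι', _, caps', cod', glob', _, _⟩ := g
  cases hι; cases hcod; cases hglob
  simp only [eqToHom_refl, Category.comp_id] at hcaps
  obtain rfl : caps = caps' := funext fun t => funext fun v => Iso.ext (hcaps t v)
  rfl

/-- **IUTchI:Def6.4(iii)** (kurims p.163) Constructor from the TRANSPORT FORM of the `Θ^{ell}`-compatibility
(`compatEll_iff_transport`). ([IUTchI] Def 6.4 (iii) p.163) [claim: Mochizuki2012, status: disputed] -/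
def ofTransport (ι : H₁.T ≃ H₂.T) (ι_charts : ∀ e ∈ H₂.grpT.charts, ι.trans e ∈ H₁.grpT.charts)
    (caps : ∀ t, (H₁.capsule t).Iso (H₂.capsule (ι t))) (cod : H₁.codomain.Iso H₂.codomain)
    (glob : H₁.glob ≅ H₂.glob)
    (compatPM : ∀ t, DStrip.polyComp (DStrip.plusFullPolyIso (caps t)) (H₂.polyPM (ι t)) =
      DStrip.polyComp (H₁.polyPM t) (DStrip.plusFullPolyIso cod))
    (hT : ∀ t v g, g ∈ H₂.polyEll (ι t) v ↔ (caps t v).hom ≫ g ≫ (K.atV v).map glob.inv ∈ H₁.polyEll t v) :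
    DRepIso H₁ H₂ where
  ι := ι
  ι_charts := ι_charts
  caps := caps
  cod := cod
  glob := glob
  compatPM := compatPM
  compatEll t v := (compatEll_iff_transport t (ι t) (caps t) glob v).mpr (hT t v)

/-! ### Identity -/

/-- **IUTchI:Def6.4(iii)** (kurims p.163) The identity representative: identity index bijection, identity isomorphisms at every
constituent. Its orbits satisfy the compatibility conditions because `†φ^{Θ±}_t` is `+`-full and `†φ^{Θell}_{v_t}`
is `Aut_+`/`Aut_csp`-bistable (`DThetaPMEllHTStability`). ([IUTchI] Def 6.4 (iii) p.163) [claim: Mochizuki2012, status: disputed] -/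
def refl (H : K.DThetaPMEllHT) : DRepIso H H where
  ι := Equiv.refl _
  ι_charts e he := by simpa only [Equiv.refl_trans] using he
  caps t := DStrip.Iso.refl (H.capsule t)
  cod := DStrip.Iso.refl H.codomain
  glob := Iso.refl H.glob
  compatPM t := by
    show DStrip.polyComp (DStrip.plusFullPolyIso (DStrip.Iso.refl (H.capsule t))) (H.polyPM t) = _
    rw [H.polyComp_positive_polyPM, H.polyComp_polyPM_positive]
  compatEll t v := H.ellCompat_refl t v

/-! ### Composition -/

/-- **IUTchI:Def6.4(i)** (kurims p.162) "There is an evident notion of composition of morphisms": composite index bijection,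
composite representatives. The Def 6.4 (i) compatibility of the composite is associativity of `polyComp`
together with `Aut_+`-orbits composing (`DStrip.polyComp_plusFullPolyIso`); the Def 6.4 (ii) compatibility is
proved in transport form. ([IUTchI] Def 6.4 (i) p.162) [claim: Mochizuki2012, status: disputed] -/
def trans (f : DRepIso H₁ H₂) (g : DRepIso H₂ H₃) : DRepIso H₁ H₃ :=
  ofTransport (f.ι.trans g.ι)
    (fun e he => by simpa only [Equiv.trans_assoc] using f.ι_charts _ (g.ι_charts e he))
    (fun t => (f.caps t).trans (g.caps (f.ι t))) (f.cod.trans g.cod) (f.glob ≪≫ g.glob)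
    (fun t => by
      show DStrip.polyComp (DStrip.plusFullPolyIso ((f.caps t).trans (g.caps (f.ι t))))
          (H₃.polyPM (g.ι (f.ι t))) = DStrip.polyComp (H₁.polyPM t) (DStrip.plusFullPolyIso (f.cod.trans g.cod))
      rw [← DStrip.polyComp_plusFullPolyIso, DStrip.polyComp_assoc, g.compatPM, ← DStrip.polyComp_assoc,
        f.compatPM, DStrip.polyComp_assoc, DStrip.polyComp_plusFullPolyIso])
    (fun t v k => by
      refine (g.transport (f.ι t) v k).trans ?_
      refine (f.transport t v _).trans ?_
      simp only [DStrip.Iso.trans, Iso.trans_hom, Iso.trans_inv, Functor.map_comp, Category.assoc]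
      exact Iff.rfl)

/-! ### Inverse -/

/-- **IUTchI:Def6.4(iii)** (kurims p.163) The inverse representative: inverse index bijection, inverse isomorphisms (the capsule
representative at `t' ∈ T'` is the inverse of the one at `ι⁻¹(t')`, re-typed along `ι(ι⁻¹ t') = t'`).
([IUTchI] Def 6.4 (iii) p.163) [claim: Mochizuki2012, status: disputed] -/
def symm (f : DRepIso H₁ H₂) : DRepIso H₂ H₁ :=
  ofTransport f.ι.symm (isIso_symm H₁.grpT H₂.grpT f.ι_charts)
    (fun t' => (capsCast H₂ (f.ι.apply_symm_apply t').symm).trans (f.caps (f.ι.symm t')).symm)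
    f.cod.symm f.glob.symm
    (fun t' => by
      obtain ⟨θ₁, hθ₁⟩ := H₁.exists_polyPM_eq
      obtain ⟨θ₂, hθ₂⟩ := H₂.exists_polyPM_eq
      have E := f.compatPM (f.ι.symm t')
      rw [hθ₁, hθ₂, DStrip.polyComp_plusFullPolyIso, DStrip.polyComp_plusFullPolyIso,
        DStrip.plusFullPolyIso_eq_iff] at E
      show DStrip.polyComp (DStrip.plusFullPolyIso
          ((capsCast H₂ (f.ι.apply_symm_apply t').symm).trans (f.caps (f.ι.symm t')).symm))
          (H₁.polyPM (f.ι.symm t')) = DStrip.polyComp (H₂.polyPM t') (DStrip.plusFullPolyIso f.cod.symm)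
      rw [hθ₁, hθ₂, DStrip.polyComp_plusFullPolyIso, DStrip.polyComp_plusFullPolyIso,
        DStrip.plusFullPolyIso_eq_iff]
      intro v
      have Ev := E v
      have hc := labMap_capsCast_trans H₂ (f.ι.apply_symm_apply t').symm θ₂ v
      simp only [DStrip.Iso.trans, DStrip.Iso.symm, K.labMap_trans, labMap_symm] at Ev hc ⊢
      have key : (K.labMap v (f.caps (f.ι.symm t') v)).symm.trans (K.labMap v (θ₁ (f.ι.symm t') v)) =
          (K.labMap v (θ₂ (f.ι (f.ι.symm t')) v)).trans (K.labMap v (f.cod v)).symm := by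
        have hC : K.labMap v (θ₁ (f.ι.symm t') v) =
            ((K.labMap v (θ₁ (f.ι.symm t') v)).trans (K.labMap v (f.cod v))).trans
              (K.labMap v (f.cod v)).symm := by
          rw [Equiv.trans_assoc, Equiv.self_trans_symm, Equiv.trans_refl]
        rw [hC, ← Ev, ← Equiv.trans_assoc, ← Equiv.trans_assoc, Equiv.symm_trans_self, Equiv.refl_trans]
      rw [← hc, Equiv.trans_assoc, key, ← Equiv.trans_assoc])
    (fun t' v k => by
      have hs : t' = f.ι (f.ι.symm t') := (f.ι.apply_symm_apply t').symm
      set k' := (f.caps (f.ι.symm t') v).inv ≫ k ≫ (K.atV v).map f.glob.hom with hk'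
      have e1 : (((capsCast H₂ hs).trans (f.caps (f.ι.symm t')).symm) v).hom ≫ k ≫
          (K.atV v).map f.glob.symm.inv = (capsCast H₂ hs v).hom ≫ k' := by
        simp only [hk', DStrip.Iso.trans, DStrip.Iso.symm, Iso.trans_hom, Iso.symm_hom, Iso.symm_inv,
          Category.assoc]
      show k ∈ H₁.polyEll (f.ι.symm t') v ↔
        (((capsCast H₂ hs).trans (f.caps (f.ι.symm t')).symm) v).hom ≫ k ≫
          (K.atV v).map f.glob.symm.inv ∈ H₂.polyEll t' v
      rw [e1, polyEll_capsCast_iff H₂ hs v k', f.transport (f.ι.symm t') v k', hk']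
      simp only [Category.assoc, Iso.hom_inv_id_assoc, ← Functor.map_comp, Iso.hom_inv_id,
        CategoryTheory.Functor.map_id, Category.comp_id])

end DRepIso

end DHTRep

end Literature.IUT.LogThetaLattice
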